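import Summits.MatrixMultiplication.OmegaCensus.ThreeSetZ5Z5Cover6
import Summits.MatrixMultiplication.OmegaCensus.ThreeSetCharacterIdentities
import Summits.MatrixMultiplication.OmegaCensus.ThreeSetAffineSpan
import Summits.MatrixMultiplication.OmegaCensus.ThreeSetLineSymmetry
import Summits.MatrixMultiplication.OmegaCensus.ThreeSetNoPartThreeCorollaries
import Summits.MatrixMultiplication.OmegaCensus.ThreeSetZ4Z4Cells
import Summits.MatrixMultiplication.OmegaCensus.DominoZpZpGL2
import Summits.MatrixMultiplication.OmegaCensus.CubeSymmetricForm
import HarnessLib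

/-!
# No cube law triple with parts `3` and `6` over any odd-order `A ↠ ℤ₅ × ℤ₅` (the census cell `(3,6,6)@325` and its column)

ω-census `pub-omega`, family (b3), seat pub-omega-group gen 36.  Framing: lottery ticket; floor = certified bounds/negative
ranges.  VALUE: a kernel theorem about the group-theoretic method (TPP capacity of dihedral-like groups) — the `ℤ₅²`-quotient
analogue, for the THREE-SET shape `(3, 6, ·)`, of the `ℤ₄²` three-set cell theorems of gens 14–18; NOT progress on ω.
Census: the cell `(3,6,6)` of `ℤ₅ × ℤ₆₅ = ℤ₅² × ℤ₁₃` (`|A| = 325`, NR79, hitherto ENGINE ×2) is KERNEL, together with every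
`(3,6,e)` cell of every odd-order abelian group with a `ℤ₅ × ℤ₅` quotient (all orders at once).

**Theorem (`no_cube_form_36_of_onto_z5z5`).**  Let `Φ : A ↠ ZMod 5 × ZMod 5` and let `(W, X, Y, x₀)` be a three-set cube
SYMMETRIC form over `A` (`−W+X+Y ⊔ W−X+Y ⊔ W+X−Y = A ∖ {x₀}`, each box direct — the reduced form of every cube law triple over
a group in which every element is a double, `cube_symmetric_form_of_law`) with `|W| = 3` and `|X| = 6`.  Then `False`.
*Proof.*  `W = {w₀, w₁, w₂}`; translate by `−w₀` (`cube_symmetric_form_translate`).  If `Φ(w₁−w₀), Φ(w₂−w₀)` were linearly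
dependent, `W` would lie in a coset of the proper subgroup `ker(λ∘Φ)` for a non-zero linear form `λ`, contradicting
`card_eq_one_of_subset_coset`; so a basis change (`ZpZpDomino.basisEquiv`) makes `Φ(W − w₀) = {0, e₁, e₂}`.  The image multiset
of `X − w₀` (`25` values `g`, `Σ g = 6`) and the hole position `σ` of `x₀ − w₀` have, by the kernel cover
`exists_lineCert3At_six`, a direction `j ≤ 5` whose three-set line datum carries a modular Farkas certificate; the three-set line
identity along `lineDir j ∘ Φ'` (`ThreeSetNorm.three_set_line_identity`) is exactly what `lineCert3At_sound` excludes.  ∎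
* TPP statements: `no_law_cube_36e_of_onto_z5z5` (parts `(3,3 | 6,6 | e,e)`), the all-orderings cell form
  `no_law_cube_three_six_of_onto_z5z5` (via `no_law_cube_two_parts_of_ordered`), both for dihedral-like `G` over `A` with every
  element a double (any `c₀`); the instance `no_law_cube_three_six_z5_z65` (`A = ℤ₅ × ℤ₆₅`, odd order `325`).
What is NOT here: the shapes `(3,3,·)` and `(3,4,·)` — their `ℤ₅²` data have genuine local solutions at `|A| = 325`
(`W`, `X` triangles with a common centroid `= Φ(x₀)`; seat notes RESULTS-g36), so `(3,3,12)@325`, `(3,4,9)@325` stay ENGINE.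
-/

namespace Summit.MatrixMultiplication.OmegaCensus

open Finset ZpZpDomino Z5Z5ThreeSet

/-! ## Finite facts about `ℤ₅²` -/

/-- The line images of `W = {0, e₁, e₂}`: `vecFn (wvec j)` counts `0`, `lineDir j e₁`, `lineDir j e₂`. [folklore] -/
theorem Z5Z5ThreeSet.vecFn_wvec (j : ℕ) (hj : j < 6) (t : ZMod 5) :
    vecFn (wvec j) t = (if (0 : ZMod 5) = t then 1 else 0) +
      ((if lineDir 5 j (1, 0) = t then 1 else 0) + (if lineDir 5 j (0, 1) = t then 1 else 0)) := by
  have h6 : j = 0 ∨ j = 1 ∨ j = 2 ∨ j = 3 ∨ j = 4 ∨ j = 5 := by omega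
  rcases h6 with rfl | rfl | rfl | rfl | rfl | rfl <;> revert t <;> decide

/-- Two dependent vectors of `ℤ₅²` are killed by a non-zero linear form. [folklore] -/
theorem Z5Z5ThreeSet.exists_form_of_det_eq_zero : ∀ u v : ZMod 5 × ZMod 5, u.1 * v.2 - u.2 * v.1 = 0 →
    ∃ ab : ZMod 5 × ZMod 5, ab ≠ 0 ∧ ab.1 * u.1 + ab.2 * u.2 = 0 ∧ ab.1 * v.1 + ab.2 * v.2 = 0 := by
  decide +kernel

/-- A non-zero linear form on `ℤ₅²` is onto. [folklore] -/
theorem Z5Z5ThreeSet.lmap_surjective (ab : ZMod 5 × ZMod 5) (hab : ab ≠ 0) : Function.Surjective (lmap ab.1 ab.2) := by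
  have key : ∀ ab : ZMod 5 × ZMod 5, ab ≠ 0 → ∀ t : ZMod 5, ∃ u : ZMod 5 × ZMod 5, ab.1 * u.1 + ab.2 * u.2 = t := by
    decide +kernel
  intro t
  obtain ⟨u, hu⟩ := key ab hab t
  exact ⟨u, by rw [lmap_apply]; exact hu⟩

/-! ## The three-set form theorem -/

section Core

variable {A : Type*} [AddCommGroup A] [Fintype A] [DecidableEq A]

/-- **No three-set cube symmetric form with `|W| = 3`, `|X| = 6` over `A ↠ ℤ₅ × ℤ₅`.** [folklore] -/
theorem no_cube_form_36_of_onto_z5z5 (Φ : A →+ ZMod 5 × ZMod 5) (hΦ : Function.Surjective Φ)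
    {W X Y : Finset A} {x₀ : A} (hW : W.card = 3) (hX : X.card = 6)
    (h₁ : Set.InjOn (fun p : A × A × A => -p.1 + p.2.1 + p.2.2) ↑(W ×ˢ X ×ˢ Y))
    (h₂ : Set.InjOn (fun p : A × A × A => p.1 - p.2.1 + p.2.2) ↑(W ×ˢ X ×ˢ Y))
    (h₃ : Set.InjOn (fun p : A × A × A => p.1 + p.2.1 - p.2.2) ↑(W ×ˢ X ×ˢ Y))
    (d₁₂ : Disjoint ((W ×ˢ X ×ˢ Y).image fun p : A × A × A => -p.1 + p.2.1 + p.2.2)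
      ((W ×ˢ X ×ˢ Y).image fun p : A × A × A => p.1 - p.2.1 + p.2.2))
    (d₁₃ : Disjoint ((W ×ˢ X ×ˢ Y).image fun p : A × A × A => -p.1 + p.2.1 + p.2.2)
      ((W ×ˢ X ×ˢ Y).image fun p : A × A × A => p.1 + p.2.1 - p.2.2))
    (d₂₃ : Disjoint ((W ×ˢ X ×ˢ Y).image fun p : A × A × A => p.1 - p.2.1 + p.2.2)
      ((W ×ˢ X ×ˢ Y).image fun p : A × A × A => p.1 + p.2.1 - p.2.2))
    (hcover : ((W ×ˢ X ×ˢ Y).image fun p : A × A × A => -p.1 + p.2.1 + p.2.2) ∪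
      ((W ×ˢ X ×ˢ Y).image fun p : A × A × A => p.1 - p.2.1 + p.2.2) ∪
      ((W ×ˢ X ×ˢ Y).image fun p : A × A × A => p.1 + p.2.1 - p.2.2) = univ.erase x₀) : False := by
  classical
  obtain ⟨w₀, w₁, w₂, h01, h02, h12, hWeq⟩ := card_eq_three.1 hW
  obtain ⟨t₁, t₂, t₃, e₁₂, e₁₃, e₂₃, tcov, cW, cX, -⟩ :=
    cube_symmetric_form_translate h₁ h₂ h₃ d₁₂ d₁₃ d₂₃ hcover (-w₀)
  set W' := W.image (· + -w₀) with hW'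
  set X' := X.image (· + -w₀) with hX'
  set Y' := Y.image (· + -w₀) with hY'
  set u := w₁ - w₀ with hu
  set v := w₂ - w₀ with hv
  have hWt : W' = {0, u, v} := by
    rw [hW', hWeq, image_insert, image_insert, image_singleton, add_neg_cancel, hu, hv, sub_eq_add_neg, sub_eq_add_neg]
  have hu0 : u ≠ 0 := sub_ne_zero.2 (Ne.symm h01)
  have hv0 : v ≠ 0 := sub_ne_zero.2 (Ne.symm h02)
  have huv : u ≠ v := fun e => h12 (sub_left_injective e)
  by_cases hD : (Φ u).1 * (Φ v).2 - (Φ u).2 * (Φ v).1 = 0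
  · -- degenerate images: `W'` lies in the proper subgroup `ker (λ ∘ Φ)`
    obtain ⟨ab, hab, hau, hav⟩ := exists_form_of_det_eq_zero (Φ u) (Φ v) hD
    set ψ : A →+ ZMod 5 := (lmap ab.1 ab.2).comp Φ with hψ
    have hψs : Function.Surjective ψ := (lmap_surjective ab hab).comp hΦ
    have hH : ψ.ker ≠ ⊤ := by
      intro htop
      obtain ⟨a, ha⟩ := hψs 1
      have hmem : a ∈ ψ.ker := by rw [htop]; exact AddSubgroup.mem_top a
      rw [AddMonoidHom.mem_ker] at hmem
      exact absurd (ha.symm.trans hmem) (by decide)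
    have hcard := card_eq_one_of_subset_coset t₁ t₂ t₃ e₁₂ e₁₃ e₂₃ tcov ψ.ker hH 0 (fun w hw => by
      rw [sub_zero, AddMonoidHom.mem_ker]
      rw [hWt] at hw
      simp only [mem_insert, mem_singleton] at hw
      rcases hw with rfl | rfl | rfl
      · exact map_zero ψ
      · show lmap ab.1 ab.2 (Φ u) = 0
        rw [lmap_apply]; exact hau
      · show lmap ab.1 ab.2 (Φ v) = 0
        rw [lmap_apply]; exact hav)
    rw [cW, hW] at hcard
    omega
  · -- a basis change puts `Φ(W') = {0, e₁, e₂}`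
    haveI : Fact (Nat.Prime 5) := ⟨by norm_num⟩
    set E := basisEquiv (Φ u) (Φ v) hD with hE
    set Φ' : A →+ ZMod 5 × ZMod 5 := E.symm.toAddMonoidHom.comp Φ with hΦ'
    have hΦ's : Function.Surjective Φ' := E.symm.surjective.comp hΦ
    have hΦ'u : Φ' u = (1, 0) := by
      show E.symm (Φ u) = _
      rw [AddEquiv.symm_apply_eq]; exact (basisEquiv_one_zero _ _ hD).symm
    have hΦ'v : Φ' v = (0, 1) := by
      show E.symm (Φ v) = _
      rw [AddEquiv.symm_apply_eq]; exact (basisEquiv_zero_one _ _ hD).symm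
    -- hole position and the image multiset of `X'`
    set s : ZMod 5 × ZMod 5 := Φ' (x₀ + -w₀) with hs
    set σ : ℕ := ptIdx 5 s with hσdef
    have hσ : σ < 25 := ptIdx_lt 5 s
    set g : Fin (5 * 5) → ℕ := fun i => (X'.filter fun a => Φ' a = pt 5 i.val).card with hg
    have hgsum : ∑ i, g i = 6 := by
      have h0 := ZpZpDomino.sum_card_fibre_shift Φ' X' 0
      rw [sum_eq_sum_pt 5] at h0
      simp only [add_zero] at h0
      rw [cX, hX] at h0
      exact h0
    obtain ⟨j, hj, certs, hcert⟩ := exists_lineCert3At_six σ hσ g hgsum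
    -- the line identity in direction `j`
    set π : ZMod 5 × ZMod 5 →+ ZMod 5 := lineDir 5 j with hπ
    set φ : A →+ ZMod 5 := π.comp Φ' with hφ
    have hφs : Function.Surjective φ := (lineDir_surjective 5 j).comp hΦ's
    have eφ : ∀ a, φ a = π (Φ' a) := fun a => rfl
    have hWc : ∀ t : ZMod 5, (W'.filter fun a => φ a = t).card = vecFn (wvec j) t := by
      intro t
      rw [vecFn_wvec j hj t, hWt, card_filter, sum_insert (by simp [hu0.symm, hv0.symm]),
        sum_insert (by simpa using huv), sum_singleton, map_zero, eφ u, eφ v, hΦ'u, hΦ'v]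
    have hXc : ∀ t : ZMod 5, (X'.filter fun a => φ a = t).card = vecFn (cnts 5 j g) t := by
      intro t
      show _ = (cnts 5 j g).getD t.val 0
      rw [getD_cnts j g (ZMod.val_lt t), ← sum_filter_eq_sum_pick 5 j (fun w => (X'.filter fun a => Φ' a = w).card)
        (ZMod.val_lt t), ZMod.natCast_zmod_val, ← card_fibre_comp_eq_sum Φ' π X' t]
      simp only [eφ]
    have hhole : φ (x₀ + -w₀) = ((pv 5 j σ : ℕ) : ZMod 5) := by
      rw [eφ, ← hs, ← pt_ptIdx 5 s, ← hσdef, ← lineDir_pt_val 5 j σ, ZMod.natCast_zmod_val]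
    refine lineCert3At_sound hcert (fun t => (Y'.filter fun a => φ a = t).card)
      (univ.filter fun a : A => φ a = 0).card (lineMat3_identity_of_double_sum fun t => ?_)
    have hid := ThreeSetNorm.three_set_line_identity φ hφs t₁ t₂ t₃ e₁₂ e₁₃ e₂₃ tcov t
    simp only [hWc, hXc, hhole] at hid
    exact hid

end Core

/-! ## The TPP statements -/

section DihedralLike

variable {A : Type} [AddCommGroup A] [DecidableEq A] [Fintype A] {G : Type} [Group G] [DecidableEq G]
  {ρ τ : A → G} {c₀ : A} {S T U : Finset G}

open Literature.Combinatorics.Additive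

/-- **No `(3,3 | 6,6 | e,e)` law triple over `A ↠ ℤ₅ × ℤ₅` with every element a double.**  Dihedral-like `G` over `A`
(any `c₀`), `Φ : A →+ ZMod 5 × ZMod 5` onto, `∀ c, ∃ a, a + a = c`; a TPP triple with coset parts `|S₀| = |S₁| = 3`,
`|T₀| = |T₁| = 6`, `|U₀| = |U₁|`.  Then `3|S||T||U| + 8 ≠ 8|A|`. [folklore] -/
theorem no_law_cube_36e_of_onto_z5z5
    (hρρ : ∀ a b, ρ a * ρ b = ρ (a + b)) (hρτ : ∀ a b, ρ a * τ b = τ (b - a))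
    (hτρ : ∀ a b, τ a * ρ b = τ (a + b)) (hττ : ∀ a b, τ a * τ b = ρ (c₀ + b - a))
    (hρ : Function.Injective ρ) (hτ : Function.Injective τ) (hne : ∀ a b, ρ a ≠ τ b)
    (hsurj : ∀ g, (∃ a, ρ a = g) ∨ (∃ a, τ a = g)) (hhalf : ∀ c : A, ∃ a : A, a + a = c)
    (Φ : A →+ ZMod 5 × ZMod 5) (hΦ : Function.Surjective Φ)
    (h : TripleProductProperty S T U)
    (hS₀ : (univ.filter fun a : A => ρ a ∈ S).card = 3) (hS₁ : (univ.filter fun a : A => τ a ∈ S).card = 3)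
    (hT₀ : (univ.filter fun a : A => ρ a ∈ T).card = 6) (hT₁ : (univ.filter fun a : A => τ a ∈ T).card = 6)
    (hU : (univ.filter fun a : A => ρ a ∈ U).card = (univ.filter fun a : A => τ a ∈ U).card)
    (hV : 3 * (S.card * T.card * U.card) + 8 = 8 * Fintype.card A) : False := by
  classical
  obtain ⟨W, X, Y, x₀, hWc, hXc, -, i₁, i₂, i₃, d₁₂, d₁₃, d₂₃, hcover⟩ :=
    cube_symmetric_form_of_law hρρ hρτ hτρ hττ hρ hτ hne hsurj hhalf h (by rw [hS₀, hS₁]) (by rw [hT₀, hT₁]) hU hV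
  rw [hS₀] at hWc
  rw [hT₀] at hXc
  exact no_cube_form_36_of_onto_z5z5 Φ hΦ hWc hXc i₁ i₂ i₃ d₁₂ d₁₃ d₂₃ hcover

/-- **Cell form `(3,6,·)`**: balanced coset parts, a part `3` and another part `6` (any positions) ⇒
`3|S||T||U| + 8 ≠ 8|A|` over `A ↠ ℤ₅ × ℤ₅` with every element a double (e.g. `|A|` odd). [folklore] -/
theorem no_law_cube_three_six_of_onto_z5z5
    (hρρ : ∀ a b, ρ a * ρ b = ρ (a + b)) (hρτ : ∀ a b, ρ a * τ b = τ (b - a))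
    (hτρ : ∀ a b, τ a * ρ b = τ (a + b)) (hττ : ∀ a b, τ a * τ b = ρ (c₀ + b - a))
    (hρ : Function.Injective ρ) (hτ : Function.Injective τ) (hne : ∀ a b, ρ a ≠ τ b)
    (hsurj : ∀ g, (∃ a, ρ a = g) ∨ (∃ a, τ a = g)) (hhalf : ∀ c : A, ∃ a : A, a + a = c)
    (Φ : A →+ ZMod 5 × ZMod 5) (hΦ : Function.Surjective Φ)
    (h : TripleProductProperty S T U)
    (hS : (univ.filter fun a : A => ρ a ∈ S).card = (univ.filter fun a : A => τ a ∈ S).card)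
    (hT : (univ.filter fun a : A => ρ a ∈ T).card = (univ.filter fun a : A => τ a ∈ T).card)
    (hU : (univ.filter fun a : A => ρ a ∈ U).card = (univ.filter fun a : A => τ a ∈ U).card)
    (h36 : ((univ.filter fun a : A => ρ a ∈ S).card = 3 ∧ (univ.filter fun a : A => ρ a ∈ T).card = 6) ∨
      ((univ.filter fun a : A => ρ a ∈ T).card = 3 ∧ (univ.filter fun a : A => ρ a ∈ U).card = 6) ∨
      ((univ.filter fun a : A => ρ a ∈ U).card = 3 ∧ (univ.filter fun a : A => ρ a ∈ S).card = 6) ∨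
      ((univ.filter fun a : A => ρ a ∈ S).card = 6 ∧ (univ.filter fun a : A => ρ a ∈ T).card = 3) ∨
      ((univ.filter fun a : A => ρ a ∈ T).card = 6 ∧ (univ.filter fun a : A => ρ a ∈ U).card = 3) ∨
      ((univ.filter fun a : A => ρ a ∈ U).card = 6 ∧ (univ.filter fun a : A => ρ a ∈ S).card = 3)) :
    3 * (S.card * T.card * U.card) + 8 ≠ 8 * Fintype.card A :=
  no_law_cube_two_parts_of_ordered 3 6
    (fun h' hS₀ hS₁ hT₀ hT₁ hU' hV => no_law_cube_36e_of_onto_z5z5 hρρ hρτ hτρ hττ hρ hτ hne hsurj hhalf Φ hΦ h'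
      hS₀ hS₁ hT₀ hT₁ hU' hV) h hS hT hU h36

/-- The projection `ℤ₅ × ℤ₆₅ ↠ ℤ₅ × ℤ₅`, `(a, b) ↦ (a, b mod 5)`. [folklore] -/
def Z5Z5ThreeSet.projZ5Z65 : ZMod 5 × ZMod 65 →+ ZMod 5 × ZMod 5 :=
  (AddMonoidHom.id (ZMod 5)).prodMap (ZMod.castHom (show 5 ∣ 65 by norm_num) (ZMod 5)).toAddMonoidHom

/-- `projZ5Z65` is onto. [folklore] -/
theorem Z5Z5ThreeSet.projZ5Z65_surjective : Function.Surjective projZ5Z65 := by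
  intro x
  refine ⟨(x.1, ((x.2.val : ℕ) : ZMod 65)), ?_⟩
  ext
  · rfl
  · show ZMod.castHom (show 5 ∣ 65 by norm_num) (ZMod 5) ((x.2.val : ℕ) : ZMod 65) = x.2
    rw [map_natCast, ZMod.natCast_zmod_val]

/-- **Census instance `(3,6,6)@325`**: for every dihedral-like group over `A = ℤ₅ × ℤ₆₅` (order `325`, any `c₀`) no TPP triple with
balanced coset parts having a part `3` and another part `6` attains `3|S||T||U| + 8 = 8|A|`. [folklore] -/
theorem no_law_cube_three_six_z5_z65 {ρ τ : ZMod 5 × ZMod 65 → G} {c₀ : ZMod 5 × ZMod 65}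
    (hρρ : ∀ a b, ρ a * ρ b = ρ (a + b)) (hρτ : ∀ a b, ρ a * τ b = τ (b - a))
    (hτρ : ∀ a b, τ a * ρ b = τ (a + b)) (hττ : ∀ a b, τ a * τ b = ρ (c₀ + b - a))
    (hρ : Function.Injective ρ) (hτ : Function.Injective τ) (hne : ∀ a b, ρ a ≠ τ b)
    (hsurj : ∀ g, (∃ a, ρ a = g) ∨ (∃ a, τ a = g))
    (h : TripleProductProperty S T U)
    (hS : (univ.filter fun a => ρ a ∈ S).card = (univ.filter fun a => τ a ∈ S).card)
    (hT : (univ.filter fun a => ρ a ∈ T).card = (univ.filter fun a => τ a ∈ T).card)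
    (hU : (univ.filter fun a => ρ a ∈ U).card = (univ.filter fun a => τ a ∈ U).card)
    (h36 : ((univ.filter fun a => ρ a ∈ S).card = 3 ∧ (univ.filter fun a => ρ a ∈ T).card = 6) ∨
      ((univ.filter fun a => ρ a ∈ T).card = 3 ∧ (univ.filter fun a => ρ a ∈ U).card = 6) ∨
      ((univ.filter fun a => ρ a ∈ U).card = 3 ∧ (univ.filter fun a => ρ a ∈ S).card = 6) ∨
      ((univ.filter fun a => ρ a ∈ S).card = 6 ∧ (univ.filter fun a => ρ a ∈ T).card = 3) ∨
      ((univ.filter fun a => ρ a ∈ T).card = 6 ∧ (univ.filter fun a => ρ a ∈ U).card = 3) ∨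
      ((univ.filter fun a => ρ a ∈ U).card = 6 ∧ (univ.filter fun a => ρ a ∈ S).card = 3)) :
    3 * (S.card * T.card * U.card) + 8 ≠ 8 * Fintype.card (ZMod 5 × ZMod 65) :=
  no_law_cube_three_six_of_onto_z5z5 hρρ hρτ hτρ hττ hρ hτ hne hsurj
    (exists_add_self_eq_of_card_odd (by rw [Fintype.card_prod, ZMod.card, ZMod.card]; decide))
    projZ5Z65 projZ5Z65_surjective h hS hT hU h36

end DihedralLike

end Summit.MatrixMultiplication.OmegaCensus
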